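import Literature.MathematicalPhysics.QuantumFieldTheory.Balaban1983to89.B1RG242Torus
import Literature.MathematicalPhysics.QuantumFieldTheory.Balaban1983to89.B8HessianSupWitness

/-!
# Bałaban CMP 99 (1985) 75–102 [B8], Theorem 8 (p. 101) — the MODEL SIDE of the cell objection GAPS G-B8-13,
# kernel-checked on the tori of record: a block-mean-zero `λ₀` on `T_ε` with `|Δ^ε_1 λ₀| ≤ 2` everywhere and
# `(∂^ε_1 ∂^ε_2 λ₀)(x₀) ≥ (K − 1)·log L − 5/2`

statement-level skeleton of published theorems with citation tags; proofs where landed; nothing here is a claim about the Yang–Mills mass gap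

Bałaban, T.: "Spaces of regular gauge field configurations on a lattice and gauge fixing conditions", Commun. Math.
Phys. 99 (1985) 75–102 [cite: Balaban1985RegularSpaces] (B8 of the cell's reading list; PDF page = journal page − 74);
its reference [4] = Bałaban, T.: "Propagators for lattice gauge theories in a background field", Commun. Math. Phys.
99 (1985) 389–434 [cite: Balaban1985BackgroundPropagators].

WHAT IS PRINTED.  Theorem 8 (p. 101, verbatim): "There exist constants B₁, B₂(β₀), c₁ such that for arbitrary U₀,
U′U₀ satisfying (1.33)–(1.35) with α₀ + α₁ ≤ c₁, and for an arbitrary function f from the space R(U₀) satisfying the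
bound |f|₍₋₂₎ < γ(α₀ + α₁), there exists exactly one gauge transformation u satisfying (1.29) and such, that the
conditions (1.36), (1.37), (1.39), and (1.146) hold for the configuration U₁ = U′^{u⁻¹}.  The constants B₁, B₂(β₀)
are as in Theorems 2, 4, the constant c₁ depends on d, L and γ."  Here (1.146) is "R(U₀)D^{η*}_{U₀}A = f" (p. 101),
(1.29) restricts u by "(R₀ū^j)(y) = 1, y ∈ Λ_j" (p. 81), R(U₀) is (p. 80, verbatim) "an orthogonal projection in this
real Hilbert space, onto the subspace Δ_{U₀}N(Q′(U₀))", "N(Q′(U₀)) = {λ : Q′(U₀)λ = 0}", and (1.36) (p. 82) is, for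
U₁ = e^{iηA}, the triple "|A| < B₁(α₀ + α₁)(L^jη)^{−1}, |∇^η_{U₀}A| < B₁(α₀ + α₁)(L^jη)^{−2}, ‖A‖_{1,β} <
B₂(β₀)(α₀ + α₁)(L^jη)^{−2−β} on Ω_j, j = 0, 1, …, k" (as read in `B8.GFData.C136`).  The proof offered is the
sentence preceding the theorem (p. 101, verbatim): "Inspecting the proofs of the theorems and propositions we can
see easily that they work in this more general situation almost without any changes, only some constants change
their numerical values."

THE OBJECTION (GAPS G-B8-13; OWNER ADJUDICATION lit-balaban r05 2026-08-22; typed print-side as `B8.Thm8Inspected`).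
Running the inspection along the printed route — p. 86, (1.57)–(1.58) with (1.146) in place of the first equation
of (1.42) — gives A = G(U₀)J′ + G(U₀)Σ_j Q*_jΛ_j(L^jη)^{−3}B₁ + G(U₀)D^η_{U₀}f, and [4] bounds the new term in the
sup-norm table (3.42) p. 397 (entries G′, ∇_{U}G′, G′∇*_{U}, Δ_{U}G′) only as |G′∇*f|; sup|∇_{U}G′∇*_{U}f| appears only
in (3.44) p. 398, with a HÖLDER norm ‖·‖_ε of the source and a constant B′₀(ε) → ∞ as ε → 0.  Hence under the
printed hypothesis |f|₍₋₂₎ < γ(α₀ + α₁) alone the ∇-clause (and a fortiori the Hölder clause) of (1.36) is not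
delivered with k-uniform constants.  That it CANNOT be is a statement about the simplest instance — U₀ = 1, abelian
algebra, U′ = 1, f = Δλ₀ with λ₀ ∈ N(Q′) — and that instance is what this file kernel-checks, on the paper's own
finite tori and with the tree's own operators.

WHAT IS PROVED HERE (0 sorry; [folklore] finite-lattice analysis — OUR construction; nothing in this file is a
statement of the paper).  Setting: the tori of record `Site P 0 = T_ε` of `Setup` (2L^{m+K} sites per direction,
ε = L^{−K}), the operators of `B1RG242Torus` for U₀ = 1 — the K-fold block averaging `Qk P K` (= Q′_K(U₀) of p. 80 at
U₀ = 1: plain block means, B5's primed tower (1.135) as typed there), the massless Laplacian `H P 0 = Σ_μ (∂^ε_μ)ᵀ∂^ε_μ` (= Δ^η_{U₀} at U₀ = 1 on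
the whole torus) and the forward derivatives `deriv P 0 ε μ` (B1 (1.4)) — and pub-balaban b2b's ℤ² witness
`B8HessianSupWitness.v N` (x₁x₂·g_N(|x₁| + |x₂|), g_N a harmonic-number profile; |Δv_N| ≤ 2, (∂₁∂₂v_N)(0) =
H_N − 5/2 + 2/N ≥ log N − 5/2, odd in x₁).
 * §1–§4 `bump` := v_{Kb}, Kb = L^{K−1}, transplanted into the unit block over the origin of T₁^{(K)} (centre x₀ =
   (Kb, Kb, 0, …, 0), support {1, …, 2Kb − 1}² × anything ⊂ {0, …, L^K − 1}² × anything since 3L^{K−1} ≤ L^K for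
   L ≥ 3), constant along the directions 3, …, d; `lapT_bump`, `mixedT_bump`: the torus Laplacian / mixed
   difference of the bump ARE Δv_{Kb} / ∂₁∂₂v_{Kb} read in integer coordinates (the spectator directions contribute
   0; no wrap-around reaches the support); `abs_lapT_bump_le` (≤ 2), `mixedT_bump_ctr` (≥ (K − 1)·log L − 5/2,
   `B8HessianSupWitness.scales_lower_bound`).
 * §5 the unit bookkeeping against the tree's ε-lattice operators: `H_zero_mulVec` (H P 0 = −ε⁻²·lapT, via the
   transpose of the shift = backward shift, as in `B5G0BridgeP12.derivT_mulVec`), `deriv_deriv_mulVec` (∂^ε_μ∂^ε_ν = ε⁻²·mixedT); `lam0 := ε²·bump`, so `H_zero_lam0`,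
   `abs_H_zero_lam0_le` (|Δ^ε_1 λ₀| ≤ 2 pointwise), `deriv_deriv_lam0_ctr` ((∂^ε_1∂^ε_2 λ₀)(x₀) ≥ (K − 1)·log L − 5/2).
 * §6 `Qk_bump` (and `Qk_lam0`): Q′_K λ₀ = 0 — over the block at the origin by the reflection r₁ ↦ 2Kb − r₁ of the
   offsets and oddness (`B8HessianSupWitness.v_neg_fst`), over every other block because the bump vanishes there
   (fibre parametrisation `Site.fibreEquiv` of `B1RG242Torus`).
 * §7 `torus_witness` (∃ λ₀ with (i) Q′_K λ₀ = 0, (ii) |Δ^ε_1 λ₀| ≤ 2, (iii) the centre lower bound), and the uniformity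
   form `no_uniform_hessian_constant`: for every admissible d ≥ 2, L, m there is NO C with sup|∂^ε_1∂^ε_2 λ| ≤
   C·sup|Δ^ε_1 λ| for all K and all λ ∈ N(Q′_K) on T_{L^{−K}} (`withK P K` = same d, L, m, K steps).
This replaces the cell numerics N-B8-4 quoted in the docstring of `B8.Thm8Inspected` (sup|∂₁∂₂Δ^{−1}f|/sup|f| =
1.18, …, 3.35 at N = 16, …, 512) by a theorem on the tori of record with the explicit rate (K − 1)·log L − 5/2.

HONEST SCOPE.  (a) MODEL SIDE ONLY.  This file does not touch the carriers `B8.GFData` / `B8SectGH.GFData3`; the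
print-side sentence `¬ B8SectGH.Thm8PrintedAt 1 B₁ B₂ fam` for a faithful flat-abelian family (exponential chart at
U₀ = 1, constant domain sequence Ω_j = T) is the successor file (cell B8-CLOSURE §5 item 1b); besides this file it
needs only `B1RG242Torus.eq_zero_of_ker` (u restricted by (1.29) and Δ(λ − sλ₀) = 0 ⇒ λ = sλ₀) and the scaling
f = s·Δ^ε_1 λ₀, s = γ(α₀ + α₁)/4.  (b) WHAT IS AND IS NOT OBJECTED TO: only the ∇-clause and the Hölder clause of
(1.36) under the printed hypothesis on f; the |A|-clause, (1.37), (1.146), uniqueness among restricted u, and the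
full (1.36) + (1.39) under the ADDED hypothesis |D^η_{U₀}f|₍₋₃₎ < γ(α₀ + α₁) are typed as surviving
(`B8.Thm8Inspected`, `B8.thm8_exists_of_printed`, `B8SectDSource.thm8_sectD_inspected`), and the series' consumer of
Theorem 8 (CMP 102 (1985) p. 297, (125)) uses only the surviving part (pub-balaban GAPS G-B11-E3a) — no downstream
statement of the programme is affected.  (c) UNITS: `H P 0` and `deriv P 0 P.eps` carry the ε⁻¹-factors of B1
(1.4)/(1.11); `lapT`, `mixedT` are their unit-label versions and `lam0 = ε²·bump` converts exactly (`H_zero_lam0`,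
`deriv_deriv_lam0`); in print's weights (L^jη)^{n} with η = ε and Ω_j = T the top scale j = k = K has weight 1, so
"|Δ^ε_1 λ₀| ≤ 2 pointwise" is "|f|₍₋₂₎ ≤ 2" for f = Δ^ε_1 λ₀ up to the factor s, and the ∇-clause at j = k reads
sup|∇A| < B₁(α₀ + α₁).  (d) RANGES: d ≥ 2 (two directions), K ≥ 2 (a non-empty bump; K ≥ 1 for the support and
block-mean lemmas), L odd > 1 as in `Params` (so L ≥ 3 and 3L^{K−1} ≤ L^K: the reflection about the bump centre
stays inside the block); m arbitrary.  (e) The (1.5)-adjoint of ∂^ε_μ is the transpose, as typed (and flagged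
NOT-CERTIFIED (vii)) in `B1RG242Torus`; for U₀ = 1 and equal weights this is literal.  (f) No claim about the
Yang–Mills programme or the mass gap is made or implied: the file certifies that one clause of one displayed
estimate is not delivered by the printed one-sentence inspection in the simplest instance, with a rate.

CELL BOOK-KEEPING (lit-balaban r05 gen 17).  ROWS-B8 row B8.Thm8 («typed-existing · refuted-as-printed IN PART»,
v1.53); B8-CLOSURE.md §3.4 / §5 item 1; GAPS G-B8-13 OWNER ADJUDICATION (E2 model instance — kernelled here; E5).
VALUE = kernel certificate behind a referee-facing erratum candidate, NOT summit progress.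
v1.1 (docstring only): the page-1 honest-framing sentence added (referee ref-2 gen 53, N1 framing check); no declaration changed.
-/

noncomputable section

open scoped BigOperators
open Matrix Finset

namespace Literature.MathematicalPhysics.QuantumFieldTheory.Balaban1983to89.B8Thm8TorusWitness

open B1RG242Torus (avgMat Qk deriv hOp H avgMat_mulVec deriv_mulVec shiftMat shiftMat_mulVec hOp_mulVec lvl lvl_of_le
  sitesPerDir_zero_eq)
open B8HessianSupWitness (v lap mixed v_eq_zero_of_le abs_lap_v_le_two scales_lower_bound v_neg_fst)

variable (P : Params)

/-! ## §1 Two directions, the bump radius, integer coordinates of fine sites -/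

/-- The first two coordinate directions of the `d ≥ 2` torus (print's μ = 1, 2). [folklore] -/
def dir0 (hd : 2 ≤ P.d) : Fin P.d := ⟨0, by omega⟩

/-- See `dir0`. [folklore] -/
def dir1 (hd : 2 ≤ P.d) : Fin P.d := ⟨1, by omega⟩

/-- The two directions are distinct. [cite: Balaban1987RG1, (0.1) p.251] -/
theorem dir0_ne_dir1 (hd : 2 ≤ P.d) : dir0 P hd ≠ dir1 P hd := by
  simp [dir0, dir1, Fin.ext_iff]

/-- The radius of the bump: `Kb = L^{K−1}` fine sites (so that the bump sits inside ONE unit block of side `L^K` fine sites;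
the number of `L`-adic scales it spans is `K − 1`). [folklore] -/
def Kb : ℕ := P.L ^ (P.K - 1)

/-- `0 < Kb`. [cite: Balaban1987RG1, (0.1)–(0.3) pp.251–252] -/
theorem Kb_pos : 0 < Kb P := pow_pos P.L_pos _

/-- `3·Kb ≤ L^K` (`L` is odd and `> 1`, so `L ≥ 3`): the bump's support `{1, …, 2Kb − 1}²` and its reflection about the
centre lie inside ONE block `{0, …, L^K − 1}²` of the unit lattice. [cite: Balaban1987RG1, (0.1)–(0.3) pp.251–252] -/
theorem three_Kb_le (hK : 1 ≤ P.K) : 3 * Kb P ≤ P.L ^ P.K := by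
  have hL : 3 ≤ P.L := by
    obtain ⟨⟨r, hr⟩, h1⟩ := P.hL
    omega
  unfold Kb
  obtain ⟨k, hk⟩ : ∃ k, P.K = k + 1 := ⟨P.K - 1, by omega⟩
  rw [hk, Nat.add_sub_cancel, pow_succ]
  nlinarith [pow_pos P.L_pos k]

/-- `L^K ≤ N`, `N = 2L^{m+K}` the number of fine sites per direction. [cite: Balaban1987RG1, (0.1)–(0.3) pp.251–252] -/
theorem pow_K_le_sites : P.L ^ P.K ≤ P.sitesPerDir 0 := by
  unfold Params.sitesPerDir
  rw [Nat.sub_zero, pow_add]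
  have h1 : 1 ≤ P.L ^ P.m := Nat.one_le_pow _ _ P.L_pos
  nlinarith [pow_pos P.L_pos P.K]

/-- The integer coordinates of a fine site in directions 1, 2, counted from the centre `(Kb, Kb)` of the bump.
[folklore] -/
def relX (hd : 2 ≤ P.d) (x : Site P 0) : ℤ × ℤ :=
  ((((x (dir0 P hd)).val : ℤ) - Kb P), (((x (dir1 P hd)).val : ℤ) - Kb P))

/-- Transplanting a function `F` on `ℤ²` to the fine torus: `F` read in the integer coordinates `relX`. [folklore] -/
def transplant (hd : 2 ≤ P.d) (F : ℤ × ℤ → ℚ) (x : Site P 0) : ℝ := ((F (relX P hd x) : ℚ) : ℝ)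

/-- Support hypothesis on a function `F` on `ℤ²` with margin `n`: `F(a, b) = 0` as soon as `|a| ≥ Kb − n` or
`|b| ≥ Kb − n`.  The bump `v_{Kb}` has margin 1 (`supp_v`), its unit translates margin 0; the torus transfer lemmas need
margin 0. [cite: Balaban1985RegularSpaces, Thm 8 p.101 + (1.36) p.82] -/
def Supp (n : ℕ) (F : ℤ × ℤ → ℚ) : Prop :=
  ∀ a b : ℤ, (Kb P : ℤ) ≤ |a| + n ∨ (Kb P : ℤ) ≤ |b| + n → F (a, b) = 0

variable {P}

/-! ## §2 Shifts on the torus read in integer coordinates -/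

section Shifts

variable (hd : 2 ≤ P.d)

/-- Label of `x + e_μ` in direction `μ`: `(n + 1) mod N`. [folklore] -/
private theorem val_shift_self (x : Site P 0) (μ : Fin P.d) :
    ((Site.shift x μ) μ).val = ((x μ).val + 1) % P.sitesPerDir 0 := by
  haveI : Fact (1 < P.sitesPerDir 0) := ⟨P.one_lt_sitesPerDir 0⟩
  simp only [Site.shift, Function.update_self]
  rw [ZMod.val_add, ZMod.val_one]

/-- `x + e_μ` has the same labels as `x` in the other directions. [folklore] -/
private theorem shift_other (x : Site P 0) {μ ν : Fin P.d} (h : ν ≠ μ) : (Site.shift x μ) ν = x ν := by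
  simp only [Site.shift, Function.update_of_ne h]

/-- Label of `x − e_μ` in direction `μ`: `n − 1`, or `N − 1` at `n = 0`. [folklore] -/
private theorem val_unshift_self (x : Site P 0) (μ : Fin P.d) :
    ((Site.unshift x μ) μ).val = if (x μ).val = 0 then P.sitesPerDir 0 - 1 else (x μ).val - 1 := by
  haveI : Fact (1 < P.sitesPerDir 0) := ⟨P.one_lt_sitesPerDir 0⟩
  simp only [Site.unshift, Function.update_self]
  split_ifs with h0
  · have hx : x μ = 0 := by rw [← ZMod.val_eq_zero]; exact h0
    rw [hx, zero_sub, ZMod.val_neg_of_ne_zero, ZMod.val_one]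
  · have h1 : (1 : ZMod (P.sitesPerDir 0)).val ≤ (x μ).val := by rw [ZMod.val_one]; omega
    rw [ZMod.val_sub h1, ZMod.val_one]

/-- `x − e_μ` has the same labels as `x` in the other directions. [folklore] -/
private theorem unshift_other (x : Site P 0) {μ ν : Fin P.d} (h : ν ≠ μ) : (Site.unshift x μ) ν = x ν := by
  simp only [Site.unshift, Function.update_of_ne h]

/-- `(x − e_μ) + e_μ = x`. [folklore] -/
private theorem shift_unshift (x : Site P 0) (μ : Fin P.d) : Site.shift (Site.unshift x μ) μ = x := by
  unfold Site.shift Site.unshift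
  rw [Function.update_idem, Function.update_self, sub_add_cancel, Function.update_eq_self]

/-- `(x + e_μ) − e_μ = x`. [folklore] -/
private theorem unshift_shift (x : Site P 0) (μ : Fin P.d) : Site.unshift (Site.shift x μ) μ = x := by
  unfold Site.shift Site.unshift
  rw [Function.update_idem, Function.update_self, add_sub_cancel_right, Function.update_eq_self]

end Shifts

/-! ## §3 Transplanted functions under the torus shifts -/

section Transplant

variable (hd : 2 ≤ P.d) {F : ℤ × ℤ → ℚ}

/-- A margin-0 function vanishes at `|a| ≥ Kb`. [folklore] -/
private theorem F_zero_fst (hF : Supp P 0 F) {a : ℤ} (b : ℤ) (ha : (Kb P : ℤ) ≤ |a|) : F (a, b) = 0 :=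
  hF a b (Or.inl (by simpa using ha))

/-- A margin-0 function vanishes at `|b| ≥ Kb`. [folklore] -/
private theorem F_zero_snd (hF : Supp P 0 F) (a : ℤ) {b : ℤ} (hb : (Kb P : ℤ) ≤ |b|) : F (a, b) = 0 :=
  hF a b (Or.inr (by simpa using hb))

/-- `3·Kb ≤ N`: the torus is long enough that no unit step from the bump's neighbourhood wraps. [folklore] -/
private theorem N_ge (hK : 1 ≤ P.K) : 3 * Kb P ≤ P.sitesPerDir 0 :=
  le_trans (three_Kb_le P hK) (pow_K_le_sites P)

/-- Forward shift in direction 1 read in integer coordinates (both sides vanish across the seam of the torus, by the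
support hypothesis). [cite: Balaban1987RG1, (0.1) p.251] -/
theorem transplant_shift_dir0 (hK : 1 ≤ P.K) (hF : Supp P 0 F) (x : Site P 0) :
    transplant P hd F (Site.shift x (dir0 P hd)) = ((F ((relX P hd x).1 + 1, (relX P hd x).2) : ℚ) : ℝ) := by
  unfold transplant relX
  rw [shift_other x (dir0_ne_dir1 P hd).symm, val_shift_self]
  set a := (x (dir0 P hd)).val with ha
  set b : ℤ := ((x (dir1 P hd)).val : ℤ) - Kb P with hb
  have haN : a < P.sitesPerDir 0 := ZMod.val_lt _
  have hN := N_ge (P := P) hK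
  by_cases hwrap : a + 1 < P.sitesPerDir 0
  · rw [Nat.mod_eq_of_lt hwrap]; push_cast; ring_nf
  · have hEq : a + 1 = P.sitesPerDir 0 := by omega
    rw [hEq, Nat.mod_self]
    push_cast
    rw [F_zero_fst (P := P) hF b (by simp), F_zero_fst (P := P) hF b ?_]
    rw [abs_of_nonneg] <;> omega

/-- Backward shift in direction 1 read in integer coordinates. [cite: Balaban1987RG1, (0.1) p.251] -/
theorem transplant_unshift_dir0 (hK : 1 ≤ P.K) (hF : Supp P 0 F) (x : Site P 0) :
    transplant P hd F (Site.unshift x (dir0 P hd)) = ((F ((relX P hd x).1 - 1, (relX P hd x).2) : ℚ) : ℝ) := by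
  unfold transplant relX
  rw [unshift_other x (dir0_ne_dir1 P hd).symm, val_unshift_self]
  set a := (x (dir0 P hd)).val with ha
  set b : ℤ := ((x (dir1 P hd)).val : ℤ) - Kb P with hb
  have haN : a < P.sitesPerDir 0 := ZMod.val_lt _
  have hN := N_ge (P := P) hK
  have hKb := Kb_pos P
  split_ifs with h0
  · rw [h0]
    push_cast
    rw [F_zero_fst (P := P) hF b ?_, F_zero_fst (P := P) hF b ?_]
    · rw [abs_of_nonpos] <;> omega
    · rw [Nat.cast_sub (by omega), abs_of_nonneg] <;> omega
  · rw [Nat.cast_sub (by omega)]; push_cast; ring_nf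

/-- Forward shift in direction 2 read in integer coordinates. [cite: Balaban1987RG1, (0.1) p.251] -/
theorem transplant_shift_dir1 (hK : 1 ≤ P.K) (hF : Supp P 0 F) (x : Site P 0) :
    transplant P hd F (Site.shift x (dir1 P hd)) = ((F ((relX P hd x).1, (relX P hd x).2 + 1) : ℚ) : ℝ) := by
  unfold transplant relX
  rw [shift_other x (dir0_ne_dir1 P hd), val_shift_self]
  set a : ℤ := ((x (dir0 P hd)).val : ℤ) - Kb P with ha
  set b := (x (dir1 P hd)).val with hb
  have hbN : b < P.sitesPerDir 0 := ZMod.val_lt _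
  have hN := N_ge (P := P) hK
  by_cases hwrap : b + 1 < P.sitesPerDir 0
  · rw [Nat.mod_eq_of_lt hwrap]; push_cast; ring_nf
  · have hEq : b + 1 = P.sitesPerDir 0 := by omega
    rw [hEq, Nat.mod_self]
    push_cast
    rw [F_zero_snd (P := P) hF a (by simp), F_zero_snd (P := P) hF a ?_]
    rw [abs_of_nonneg] <;> omega

/-- Backward shift in direction 2 read in integer coordinates. [cite: Balaban1987RG1, (0.1) p.251] -/
theorem transplant_unshift_dir1 (hK : 1 ≤ P.K) (hF : Supp P 0 F) (x : Site P 0) :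
    transplant P hd F (Site.unshift x (dir1 P hd)) = ((F ((relX P hd x).1, (relX P hd x).2 - 1) : ℚ) : ℝ) := by
  unfold transplant relX
  rw [unshift_other x (dir0_ne_dir1 P hd), val_unshift_self]
  set a : ℤ := ((x (dir0 P hd)).val : ℤ) - Kb P with ha
  set b := (x (dir1 P hd)).val with hb
  have hbN : b < P.sitesPerDir 0 := ZMod.val_lt _
  have hN := N_ge (P := P) hK
  have hKb := Kb_pos P
  split_ifs with h0
  · rw [h0]
    push_cast
    rw [F_zero_snd (P := P) hF a ?_, F_zero_snd (P := P) hF a ?_]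
    · rw [abs_of_nonpos] <;> omega
    · rw [Nat.cast_sub (by omega), abs_of_nonneg] <;> omega
  · rw [Nat.cast_sub (by omega)]; push_cast; ring_nf

/-- Shifts in the remaining directions do not move the integer coordinates. [cite: Balaban1987RG1, (0.1) p.251] -/
theorem transplant_shift_other (x : Site P 0) {μ : Fin P.d} (h0 : μ ≠ dir0 P hd) (h1 : μ ≠ dir1 P hd) :
    transplant P hd F (Site.shift x μ) = transplant P hd F x := by
  unfold transplant relX
  rw [shift_other x h0.symm, shift_other x h1.symm]

/-- See `transplant_shift_other`. [cite: Balaban1987RG1, (0.1) p.251] -/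
theorem transplant_unshift_other (x : Site P 0) {μ : Fin P.d} (h0 : μ ≠ dir0 P hd) (h1 : μ ≠ dir1 P hd) :
    transplant P hd F (Site.unshift x μ) = transplant P hd F x := by
  unfold transplant relX
  rw [unshift_other x h0.symm, unshift_other x h1.symm]

end Transplant

/-! ## §4 The bump `v_{Kb}` of `B8HessianSupWitness` transplanted into one unit block of the torus of record -/

section Bump

variable (P) (hd : 2 ≤ P.d)

/-- The unit-spacing torus Laplacian `Σ_μ (f(x+e_μ) + f(x−e_μ) − 2f(x))` (all `d` directions). [folklore] -/
def lapT (f : Site P 0 → ℝ) (x : Site P 0) : ℝ := ∑ μ, (f (Site.shift x μ) + f (Site.unshift x μ) - 2 * f x)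

/-- The forward mixed second difference `f(x+e_μ+e_ν) − f(x+e_μ) − f(x+e_ν) + f(x)` (unit spacing). [folklore] -/
def mixedT (f : Site P 0 → ℝ) (μ ν : Fin P.d) (x : Site P 0) : ℝ :=
  f (Site.shift (Site.shift x μ) ν) - f (Site.shift x μ) - f (Site.shift x ν) + f x

/-- THE BUMP on the fine torus `T_η = Site P 0`: `x ↦ v_{Kb}(x₁ − Kb, x₂ − Kb)` (integer labels), i.e. pub-balaban b2b's
lattice-harmonic-times-logarithmic-profile witness `B8HessianSupWitness.v` of radius `Kb = L^{K−1}` centred at the fine site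
`(Kb, Kb, 0, …, 0)` — inside the unit block over the origin of `T₁^{(K)}` —, constant along the directions `3, …, d`.
[folklore] -/
def bump : Site P 0 → ℝ := transplant P hd (v (Kb P))

/-- The centre of the bump: the fine site with labels `(Kb, Kb, 0, …, 0)`. [folklore] -/
def ctr : Site P 0 := fun μ => if μ = dir0 P hd ∨ μ = dir1 P hd then ((Kb P : ℕ) : ZMod (P.sitesPerDir 0)) else 0

variable {P}

/-- The bump has margin 1: `v_{Kb}(a, b) = 0` once `|a| ≥ Kb − 1` or `|b| ≥ Kb − 1` (its support is the ℓ¹-ball of radius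
`Kb − 2`). [folklore] -/
private theorem supp_v : Supp P 1 (v (Kb P)) := by
  intro a b h
  apply v_eq_zero_of_le
  rw [Int.abs_eq_natAbs, Int.abs_eq_natAbs] at h
  omega

/-- Unit translates of a margin-1 function have margin 0. [folklore] -/
private theorem supp_translate {F : ℤ × ℤ → ℚ} (hF : Supp P 1 F) (i j : ℤ) (hi : |i| ≤ 1) (hj : |j| ≤ 1) :
    Supp P 0 (fun p => F (p.1 + i, p.2 + j)) := by
  intro a b h
  apply hF
  have h1 : |a| ≤ |a + i| + |i| := by
    have := abs_sub (a + i) i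
    rwa [add_sub_cancel_right] at this
  have h2 : |b| ≤ |b + j| + |j| := by
    have := abs_sub (b + j) j
    rwa [add_sub_cancel_right] at this
  push_cast at h ⊢
  rcases h with h | h
  · left; linarith
  · right; linarith

/-- The bump has margin 0. [folklore] -/
private theorem supp_v0 : Supp P 0 (v (Kb P)) := by
  have h := supp_translate (P := P) supp_v 0 0 (by simp) (by simp)
  simpa using h

/-- `lapT bump = (Δ v_{Kb})` read in integer coordinates: the `d − 2` spectator directions contribute nothing.
[cite: Balaban1985RegularSpaces, Thm 8 p.101 + (1.36) p.82] -/
theorem lapT_bump (hK : 1 ≤ P.K) (x : Site P 0) :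
    lapT P (bump P hd) x = ((lap (v (Kb P)) (relX P hd x) : ℚ) : ℝ) := by
  unfold lapT
  rw [Fintype.sum_eq_add (dir0 P hd) (dir1 P hd) (dir0_ne_dir1 P hd)]
  · unfold bump
    rw [transplant_shift_dir0 hd hK supp_v0, transplant_unshift_dir0 hd hK supp_v0, transplant_shift_dir1 hd hK supp_v0,
      transplant_unshift_dir1 hd hK supp_v0]
    unfold transplant lap
    push_cast
    ring
  · rintro μ ⟨h0, h1⟩
    unfold bump
    rw [transplant_shift_other hd x h0 h1, transplant_unshift_other hd x h0 h1]
    ring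

/-- `|lapT bump| ≤ 2` everywhere on the torus (`B8HessianSupWitness.abs_lap_v_le_two`). [cite: Balaban1985RegularSpaces, Thm 8 p.101 + (1.36) p.82] -/
theorem abs_lapT_bump_le (hK : 1 ≤ P.K) (x : Site P 0) : |lapT P (bump P hd) x| ≤ 2 := by
  rw [lapT_bump hd hK]
  exact_mod_cast abs_lap_v_le_two _ _

/-- `mixedT bump e₁ e₂ = (∂₁∂₂ v_{Kb})` read in integer coordinates. [cite: Balaban1985RegularSpaces, Thm 8 p.101 + (1.36) p.82] -/
theorem mixedT_bump (hK : 1 ≤ P.K) (x : Site P 0) :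
    mixedT P (bump P hd) (dir0 P hd) (dir1 P hd) x = ((mixed (v (Kb P)) (relX P hd x) : ℚ) : ℝ) := by
  set G : ℤ × ℤ → ℚ := fun p => v (Kb P) (p.1 + 0, p.2 + 1) with hG
  have hGs : Supp P 0 G := supp_translate supp_v 0 1 (by simp) (by simp)
  have e1 : transplant P hd (v (Kb P)) (Site.shift (Site.shift x (dir0 P hd)) (dir1 P hd))
      = transplant P hd G (Site.shift x (dir0 P hd)) := by
    rw [transplant_shift_dir1 hd hK supp_v0]
    simp [transplant, hG]
  have e2 := transplant_shift_dir0 hd hK hGs x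
  unfold mixedT bump
  rw [e1, e2, transplant_shift_dir0 hd hK supp_v0, transplant_shift_dir1 hd hK supp_v0]
  unfold transplant mixed
  simp only [hG, add_zero]
  push_cast
  ring

/-- The integer coordinates of the centre are `(0, 0)`. [folklore] -/
private theorem relX_ctr (hK : 1 ≤ P.K) : relX P hd (ctr P hd) = (0, 0) := by
  have hlt : Kb P < P.sitesPerDir 0 := by
    have := three_Kb_le P hK
    have := pow_K_le_sites P
    have := Kb_pos P
    omega
  have hval : (((Kb P : ℕ) : ZMod (P.sitesPerDir 0))).val = Kb P := by
    rw [ZMod.val_natCast, Nat.mod_eq_of_lt hlt]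
  unfold relX ctr
  simp only [true_or, or_true, if_true, hval, sub_self]

/-- **THE COUNT IN SCALES on the torus of record**: at the centre, `(K − 1)·log L − 5/2 ≤ (∂₁∂₂ bump)(centre)` while
`|Δ bump| ≤ 2` everywhere (`abs_lapT_bump_le`) — with `d, L` fixed and `K → ∞` the ratio is unbounded
(`B8HessianSupWitness.scales_lower_bound`, harmonic-number lower bound). [cite: Balaban1985RegularSpaces, Thm 8 p.101 + (1.36) p.82] -/
theorem mixedT_bump_ctr (hK : 2 ≤ P.K) :
    ((P.K - 1 : ℕ) : ℝ) * Real.log P.L - 5 / 2 ≤ mixedT P (bump P hd) (dir0 P hd) (dir1 P hd) (ctr P hd) := by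
  rw [mixedT_bump hd (by omega), relX_ctr hd (by omega)]
  have hL : 2 ≤ P.L := by have := P.hL.2; omega
  exact scales_lower_bound P.L (P.K - 1) hL (by omega)

end Bump

/-! ## §5 Dictionary to the torus operators of `B1RG242Torus`: `Δ^ε_{U₀=1} = ε⁻²·lapT`, `∂^ε_μ∂^ε_ν = ε⁻²·mixedT` -/

section Operators

/-- `x = x′ + e_μ ↔ x′ = x − e_μ`. [folklore] -/
private theorem eq_shift_iff (x x' : Site P 0) (μ : Fin P.d) : x = Site.shift x' μ ↔ x' = Site.unshift x μ := by
  constructor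
  · rintro rfl; exact (unshift_shift x' μ).symm
  · rintro rfl; exact (shift_unshift x μ).symm

variable (P)

/-- **`H P 0 = −ε⁻²·lapT`**: the tree's massless `−Δ^ε + 0 = Σ_μ (∂^ε_μ)ᵀ∂^ε_μ` on `T_ε` (`B1RG242Torus.H`; at `U₀ = 1`
and on the whole torus this is the covariant Laplace operator of [4] (3.23) p. 394, "Δ^η_U = D^{η*}_U D^η_U", whose range
on `N(Q′)` is the space `R` of (3.21) there / of B8 p. 80) is `ε⁻²` times MINUS the unit-label torus Laplacian `lapT`.
[cite: Balaban1982Higgs1, (1.11) p.605] [cite: Balaban1985BackgroundPropagators, (3.23) p.394] -/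
theorem H_zero_mulVec (f : Site P 0 → ℝ) (x : Site P 0) : (H P 0 *ᵥ f) x = -(P.eps⁻¹ ^ 2) * lapT P f x := by
  -- `((∂^ε_μ)ᵀ g)(x) = ε⁻¹ (g(x − e_μ) − g(x))`: the transpose of the forward shift is the backward shift (this is
  -- `B5G0BridgeP12.derivT_mulVec` / `shiftMat_transpose_mulVec`, re-derived in four lines to keep this file's imports at
  -- `B1RG242Torus` rather than the B5 product-torus bridge).
  have hT : ∀ (μ : Fin P.d) (g : Site P 0 → ℝ),
      ((deriv P 0 P.eps μ)ᵀ *ᵥ g) x = P.eps⁻¹ * (g (Site.unshift x μ) - g x) := by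
    intro μ g
    have hS : ((shiftMat P 0 μ)ᵀ *ᵥ g) x = g (Site.unshift x μ) := by
      simp only [Matrix.mulVec, dotProduct, Matrix.transpose_apply, shiftMat]
      simp_rw [eq_shift_iff x _ μ, ite_mul, one_mul, zero_mul]
      rw [Finset.sum_ite_eq', if_pos (Finset.mem_univ _)]
    simp only [B1RG242Torus.deriv, Matrix.transpose_smul, Matrix.transpose_sub, Matrix.transpose_one,
      Matrix.smul_mulVec, Matrix.sub_mulVec, Matrix.one_mulVec, Pi.smul_apply, Pi.sub_apply, hS, smul_eq_mul]
  show (hOp P 0 P.eps 0 *ᵥ f) x = _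
  rw [hOp_mulVec, zero_smul, zero_add, Finset.sum_apply, lapT, Finset.mul_sum]
  refine Finset.sum_congr rfl fun μ _ => ?_
  rw [hT, deriv_mulVec, deriv_mulVec, shift_unshift]
  ring

/-- **`∂^ε_μ ∂^ε_ν = ε⁻²·mixedT`** for the tree's forward derivatives `B1RG242Torus.deriv` (B1 (1.4), `U = 1`).
[cite: Balaban1982Higgs1, (1.4) p.604] -/
theorem deriv_deriv_mulVec (s : ℝ) (μ ν : Fin P.d) (f : Site P 0 → ℝ) (x : Site P 0) :
    (deriv P 0 s μ *ᵥ (deriv P 0 s ν *ᵥ f)) x = s⁻¹ ^ 2 * mixedT P f μ ν x := by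
  rw [deriv_mulVec, deriv_mulVec, deriv_mulVec, mixedT]
  ring

variable (hd : 2 ≤ P.d)

/-- The candidate minimizer in ε-units: `λ₀ := ε²·bump`, so that `Δ^ε_{1} λ₀ = −lapT bump` is bounded by 2 (sources of
size O(1) in the norm `|·|` of p.82) while `∂^ε_1∂^ε_2 λ₀ = mixedT bump` is ≥ (K−1)·log L − 5/2 at the centre. [folklore] -/
def lam0 : Site P 0 → ℝ := (P.eps ^ 2) • bump P hd

/-- `(H P 0) λ₀ = −lapT bump` pointwise. [cite: Balaban1985RegularSpaces, Thm 8 p.101 + (1.36) p.82] -/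
theorem H_zero_lam0 (x : Site P 0) : (H P 0 *ᵥ lam0 P hd) x = -lapT P (bump P hd) x := by
  rw [lam0, Matrix.mulVec_smul, Pi.smul_apply, H_zero_mulVec, smul_eq_mul]
  have hε : P.eps ≠ 0 := P.eps_pos.ne'
  field_simp

/-- `|(H P 0) λ₀| ≤ 2` pointwise. [cite: Balaban1985RegularSpaces, Thm 8 p.101 + (1.36) p.82] -/
theorem abs_H_zero_lam0_le (hK : 1 ≤ P.K) (x : Site P 0) : |(H P 0 *ᵥ lam0 P hd) x| ≤ 2 := by
  rw [H_zero_lam0, abs_neg]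
  exact abs_lapT_bump_le hd hK x

/-- `∂^ε_1 ∂^ε_2 λ₀ = mixedT bump e₁ e₂` pointwise. [cite: Balaban1985RegularSpaces, Thm 8 p.101 + (1.36) p.82] -/
theorem deriv_deriv_lam0 (x : Site P 0) :
    (deriv P 0 P.eps (dir0 P hd) *ᵥ (deriv P 0 P.eps (dir1 P hd) *ᵥ lam0 P hd)) x
      = mixedT P (bump P hd) (dir0 P hd) (dir1 P hd) x := by
  rw [lam0, Matrix.mulVec_smul, Matrix.mulVec_smul, Pi.smul_apply, deriv_deriv_mulVec, smul_eq_mul]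
  have hε : P.eps ≠ 0 := P.eps_pos.ne'
  field_simp

/-- At the centre `∂^ε_1 ∂^ε_2 λ₀ ≥ (K − 1)·log L − 5/2`. [cite: Balaban1985RegularSpaces, Thm 8 p.101 + (1.36) p.82] -/
theorem deriv_deriv_lam0_ctr (hK : 2 ≤ P.K) :
    ((P.K - 1 : ℕ) : ℝ) * Real.log P.L - 5 / 2
      ≤ (deriv P 0 P.eps (dir0 P hd) *ᵥ (deriv P 0 P.eps (dir1 P hd) *ᵥ lam0 P hd)) (ctr P hd) := by
  rw [deriv_deriv_lam0]
  exact mixedT_bump_ctr hd hK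

end Operators

/-! ## §6 The bump is in `N(Q′_K)`: its mean over every unit block vanishes -/

section BlockMean

variable (hd : 2 ≤ P.d)

/-- `N = L^K · (sites per direction of T₁^{(K)})`. [folklore] -/
private theorem sites_eq : P.sitesPerDir 0 = P.L ^ P.K * P.sitesPerDir P.K := by
  have h := sitesPerDir_zero_eq P P.K
  rwa [lvl_of_le P (Nat.le_add_left P.K P.m)] at h

/-- The reflection `i ↦ 2c − i` on `{0, …, 2c}`, identity above `2c`. [folklore] -/
private def reflOff (n c : ℕ) (hc : 2 * c < n) (i : Fin n) : Fin n :=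
  if (i : ℕ) ≤ 2 * c then ⟨2 * c - i, lt_of_le_of_lt (Nat.sub_le _ _) hc⟩ else i

/-- Value of the reflection below `2c`. [folklore] -/
private theorem reflOff_val_of_le {n c : ℕ} (hc : 2 * c < n) {i : Fin n} (h : (i : ℕ) ≤ 2 * c) :
    ((reflOff n c hc i : Fin n) : ℕ) = 2 * c - i := by
  simp [reflOff, h]

/-- The reflection is the identity above `2c`. [folklore] -/
private theorem reflOff_of_lt {n c : ℕ} (hc : 2 * c < n) {i : Fin n} (h : 2 * c < (i : ℕ)) :
    reflOff n c hc i = i := by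
  simp [reflOff, Nat.not_le.mpr h]

/-- The reflection is an involution. [folklore] -/
private theorem reflOff_reflOff {n c : ℕ} (hc : 2 * c < n) (i : Fin n) : reflOff n c hc (reflOff n c hc i) = i := by
  by_cases h : (i : ℕ) ≤ 2 * c
  · have h1 := reflOff_val_of_le hc h
    have h2 : ((reflOff n c hc i : Fin n) : ℕ) ≤ 2 * c := by omega
    apply Fin.ext
    rw [reflOff_val_of_le hc h2, h1]
    omega
  · rw [Nat.not_le] at h
    rw [reflOff_of_lt hc h, reflOff_of_lt hc h]

/-- The reflection of the offset in direction `μ` about the bump centre. [folklore] -/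
private def rho {n c : ℕ} (hc : 2 * c < n) (μ : Fin P.d) (r : Fin P.d → Fin n) : Fin P.d → Fin n :=
  Function.update r μ (reflOff n c hc (r μ))

/-- `rho` is an involution. [folklore] -/
private theorem rho_rho {n c : ℕ} (hc : 2 * c < n) (μ : Fin P.d) (r : Fin P.d → Fin n) :
    rho hc μ (rho hc μ r) = r := by
  unfold rho
  rw [Function.update_idem, Function.update_self, reflOff_reflOff, Function.update_eq_self]

/-- `rho` reflects the `μ`-offset. [folklore] -/
private theorem rho_self {n c : ℕ} (hc : 2 * c < n) (μ : Fin P.d) (r : Fin P.d → Fin n) :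
    rho hc μ r μ = reflOff n c hc (r μ) := by
  simp [rho]

/-- `rho` leaves the other offsets unchanged. [folklore] -/
private theorem rho_other {n c : ℕ} (hc : 2 * c < n) {μ ν : Fin P.d} (h : ν ≠ μ) (r : Fin P.d → Fin n) :
    rho hc μ r ν = r ν := by
  simp [rho, h]

/-- Oddness in the first coordinate kills the sum of `v_{Kb}(r₁ − Kb, B(r₂))` over all offsets `r ∈ {0,…,n−1}^d`
(`n = L^K > 2Kb`), whatever the second argument `B`. [folklore] -/
private theorem sum_offsets_eq_zero (hK : 1 ≤ P.K) (B : Fin (P.L ^ P.K) → ℤ) :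
    ∑ r : Fin P.d → Fin (P.L ^ P.K), v (Kb P) ((((r (dir0 P hd) : ℕ) : ℤ) - Kb P), B (r (dir1 P hd))) = 0 := by
  have hc : 2 * Kb P < P.L ^ P.K := by
    have := three_Kb_le P hK
    have := Kb_pos P
    omega
  set V : (Fin P.d → Fin (P.L ^ P.K)) → ℚ :=
    fun r => v (Kb P) ((((r (dir0 P hd) : ℕ) : ℤ) - Kb P), B (r (dir1 P hd))) with hV
  have hodd : ∀ r, V (rho hc (dir0 P hd) r) = -V r := by
    intro r
    simp only [hV, rho_self, rho_other hc (dir0_ne_dir1 P hd).symm]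
    by_cases h : ((r (dir0 P hd) : ℕ)) ≤ 2 * Kb P
    · rw [reflOff_val_of_le hc h, ← v_neg_fst]
      congr 2
      push_cast [Nat.cast_sub h]
      ring
    · rw [Nat.not_le] at h
      rw [reflOff_of_lt hc h]
      have h0 : v (Kb P) ((((r (dir0 P hd) : ℕ) : ℤ) - Kb P), B (r (dir1 P hd))) = 0 := by
        apply supp_v
        left
        rw [abs_of_nonneg (by omega)]
        omega
      rw [h0, neg_zero]
  have hperm : Function.Involutive (rho hc (dir0 P hd)) := rho_rho hc (dir0 P hd)
  have hsum : ∑ r, V r = ∑ r, V (rho hc (dir0 P hd) r) :=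
    (Equiv.sum_comp hperm.toPerm V).symm
  simp only [hodd, Finset.sum_neg_distrib] at hsum
  show ∑ r, V r = 0
  linarith

/-- **THE BUMP IS IN `N(Q′_K)`**: its mean over every unit block `B^K(y)`, `y ∈ T₁^{(K)}`, vanishes — for the block over
the origin by oddness of `v_{Kb}` in `x₁ − Kb` (the reflection `r₁ ↦ 2Kb − r₁` of the offsets, `B8HessianSupWitness.v_neg_fst`),
for every other block because the bump vanishes there.  (`Qk P K` = Q′_K(U₀) of p. 80 at U₀ = 1: plain K-fold block means, the primed
tower of B5 (1.135) as typed in `B1RG242Torus.Qk`.) [cite: Balaban1985RegularSpaces, p.80 «N(Q′(U₀)) = {λ : Q′(U₀)λ = 0}»] [cite: Balaban1982Higgs1, (2.11) p.609] -/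
theorem Qk_bump (hK : 1 ≤ P.K) : Qk P P.K *ᵥ bump P hd = 0 := by
  have h := sites_eq (P := P)
  have hn : 3 * Kb P ≤ P.L ^ P.K := three_Kb_le P hK
  funext y
  show (avgMat P 0 P.K (lvl P P.K) _ *ᵥ bump P hd) y = 0
  rw [avgMat_mulVec, lvl_of_le P (Nat.le_add_left P.K P.m), ← Finset.sum_filter, ← Finset.mul_sum]
  apply mul_eq_zero_of_right
  rw [Finset.sum_subtype (Finset.univ.filter fun x : Site P 0 => Site.proj P.K P.K x = y)
    (p := fun x => Site.proj P.K P.K x = y) (by simp), ← Equiv.sum_comp (Site.fibreEquiv h y).symm]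
  -- the summand at offset `r` is the bump at the fine site `fibreSite 0 K y r`, i.e. `v_{Kb}` at integer coordinates
  have hterm : ∀ r : Fin P.d → Fin (P.L ^ P.K),
      bump P hd (((Site.fibreEquiv h y).symm r).1)
        = ((v (Kb P) ((((y (dir0 P hd)).val * P.L ^ P.K + (r (dir0 P hd) : ℕ) : ℕ) : ℤ) - Kb P,
            (((y (dir1 P hd)).val * P.L ^ P.K + (r (dir1 P hd) : ℕ) : ℕ) : ℤ) - Kb P) : ℚ) : ℝ) := by
    intro r
    show transplant P hd (v (Kb P)) (Site.fibreSite 0 P.K y r) = _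
    simp only [transplant, relX, Site.val_fibreSite h]
  simp only [hterm]
  rw [← Rat.cast_sum, Rat.cast_eq_zero]
  by_cases hy : (y (dir0 P hd)).val = 0
  · simp only [hy, zero_mul, zero_add]
    exact sum_offsets_eq_zero hd hK (fun i => (((y (dir1 P hd)).val * P.L ^ P.K + (i : ℕ) : ℕ) : ℤ) - Kb P)
  · apply Finset.sum_eq_zero
    intro r _
    apply supp_v
    left
    have hy1 : 1 ≤ (y (dir0 P hd)).val := Nat.one_le_iff_ne_zero.mpr hy
    have hmul : P.L ^ P.K ≤ (y (dir0 P hd)).val * P.L ^ P.K := Nat.le_mul_of_pos_left _ hy1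
    have ht : P.L ^ P.K ≤ (y (dir0 P hd)).val * P.L ^ P.K + (r (dir0 P hd) : ℕ) := le_add_right hmul
    generalize (y (dir0 P hd)).val * P.L ^ P.K + (r (dir0 P hd) : ℕ) = t at ht ⊢
    have := Kb_pos P
    rw [abs_of_nonneg (by omega)]
    omega

end BlockMean

/-! ## §7 Packaging: `λ₀ = ε²·bump` on the tori of record, and no `K`-uniform Hessian-by-Laplacian constant -/

section Packaging

variable (hd : 2 ≤ P.d)

/-- `Q′_K λ₀ = 0`. [cite: Balaban1985RegularSpaces, p.80 «N(Q′(U₀)) = {λ : Q′(U₀)λ = 0}»] [cite: Balaban1982Higgs1, (2.11) p.609] -/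
theorem Qk_lam0 (hK : 1 ≤ P.K) : Qk P P.K *ᵥ lam0 P hd = 0 := by
  rw [lam0, Matrix.mulVec_smul, Qk_bump hd hK, smul_zero]

/-- **THE WITNESS ON THE TORUS OF RECORD** (model side of GAPS G-B8-13, our construction): on every torus `T_ε` of the
series with `d ≥ 2` and `K ≥ 2` RG steps there is a real (= abelian Lie-algebra valued, U₀ = 1) lattice function `λ₀`
with  (i) `Q′_K λ₀ = 0` — `λ₀ ∈ N(Q′(U₀))`, p. 80: "We consider the subspace N(Q′(U₀)) = {λ : Q′(U₀)λ = 0} … An operator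
R(U₀) is defined as an orthogonal projection … onto the subspace Δ_{U₀}N(Q′(U₀))", so `f := Δ^ε_1 λ₀ ∈ R(1)`;
(ii) `|(Δ^ε_1 λ₀)(x)| ≤ 2` at every site (a source of size `O(1)` in the top-scale weight of `|f|₍₋₂₎`);
(iii) `(∂^ε_1 ∂^ε_2 λ₀)(x₀) ≥ (K − 1)·log L − 5/2` at the centre `x₀` of the bump — unbounded as `ε = L^{−K} → 0`, whereas
the ∇-clause of (1.36) for `A ∋ D^η λ₀` asks for a `k`-uniform `B₁`. [cite: Balaban1985RegularSpaces, Thm 8 p.101 + (1.36) p.82 + p.80] -/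
theorem torus_witness (hK : 2 ≤ P.K) :
    ∃ lam : Site P 0 → ℝ,
      Qk P P.K *ᵥ lam = 0 ∧ (∀ x, |(H P 0 *ᵥ lam) x| ≤ 2) ∧
        ((P.K - 1 : ℕ) : ℝ) * Real.log P.L - 5 / 2
          ≤ (deriv P 0 P.eps (dir0 P hd) *ᵥ (deriv P 0 P.eps (dir1 P hd) *ᵥ lam)) (ctr P hd) :=
  ⟨lam0 P hd, Qk_lam0 hd (by omega), abs_H_zero_lam0_le P hd (by omega), deriv_deriv_lam0_ctr P hd hK⟩

variable (P)

/-- The torus of record with the number of RG steps replaced by `K` (same `d, L, m`): the index of the family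
`ε = L^{−K} → 0` along which print's constants `B₁, B₂(β₀)` are uniform ("as in Theorems 2, 4", p. 101; p. 83,
verbatim: "Of course we want to prove that the constants B₁, B₂(β₀) in (1.36), (1.39) are absolute constants
depending on d and L only, B₂(β₀) on β₀ also."). [cite: Balaban1985RegularSpaces, Thm 8 p.101 + p.83] -/
def withK (K : ℕ) : Params := { P with K := K }

/-- **NO `K`-UNIFORM CONSTANT** (model side of GAPS G-B8-13 as a uniformity statement, our construction): for every
admissible `d ≥ 2`, `L`, `m` there is NO constant `C` such that on every torus `T_ε`, `ε = L^{−K}`, every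
`λ ∈ N(Q′_K)` (U₀ = 1) obeys `sup |∂^ε_1∂^ε_2 λ| ≤ C · sup |Δ^ε_1 λ|` — the shape in which the ∇-clause
`|∇^η_{U₀}A| < B₁(α₀ + α₁)(L^jη)^{−2}` of (1.36), for the term `G(U₀)D^η_{U₀}f = D^η Δ_{U₀}^{−1} f` of `A` produced by
the inspection route (p. 86 (1.57)–(1.58) with (1.146) in place of (1.38)) under the printed hypothesis
`|f|₍₋₂₎ < γ(α₀ + α₁)`, would have to hold in the flat abelian instance with `B₁` "as in Theorems 2, 4".  Witness at
`C`: `K` with `(K − 1)·log L − 5/2 > 2C` and `λ₀` of `torus_witness`. [cite: Balaban1985RegularSpaces, Thm 8 p.101 + (1.36) p.82] -/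
theorem no_uniform_hessian_constant (hd : 2 ≤ P.d) :
    ¬ ∃ C : ℝ, ∀ K : ℕ, ∀ lam : Site (withK P K) 0 → ℝ, ∀ B : ℝ,
      Qk (withK P K) K *ᵥ lam = 0 → (∀ y, |(H (withK P K) 0 *ᵥ lam) y| ≤ B) →
        ∀ x, |(deriv (withK P K) 0 (withK P K).eps (dir0 (withK P K) hd) *ᵥ
                (deriv (withK P K) 0 (withK P K).eps (dir1 (withK P K) hd) *ᵥ lam)) x| ≤ C * B := by
  rintro ⟨C, hC⟩
  have hL1 : (1 : ℝ) < P.L := by have := P.hL.2; exact_mod_cast this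
  have hlog : 0 < Real.log P.L := Real.log_pos hL1
  obtain ⟨n, hn⟩ := exists_nat_gt ((2 * C + 5 / 2) / Real.log P.L)
  set K : ℕ := n + 2 with hKdef
  have hK : 2 ≤ (withK P K).K := by show 2 ≤ n + 2; omega
  have h1 := hC K (lam0 (withK P K) hd) 2 (Qk_lam0 (P := withK P K) hd (by show 1 ≤ n + 2; omega))
    (abs_H_zero_lam0_le (withK P K) hd (by show 1 ≤ n + 2; omega)) (ctr (withK P K) hd)
  have h2 := deriv_deriv_lam0_ctr (withK P K) hd hK
  have h3 : (((withK P K).K - 1 : ℕ) : ℝ) = n + 1 := by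
    show (((n + 2 - 1 : ℕ) : ℝ)) = n + 1
    push_cast [show n + 2 - 1 = n + 1 by omega]
    ring
  rw [h3] at h2
  have h4 : (2 * C + 5 / 2) / Real.log P.L * Real.log P.L = 2 * C + 5 / 2 := div_mul_cancel₀ _ hlog.ne'
  have h5 : (n : ℝ) * Real.log P.L > 2 * C + 5 / 2 := by
    rw [← h4]; exact mul_lt_mul_of_pos_right hn hlog
  have h6 : (withK P K).L = P.L := rfl
  rw [h6] at h2
  have h7 := le_trans (le_abs_self _) h1
  nlinarith

end Packaging

end Literature.MathematicalPhysics.QuantumFieldTheory.Balaban1983to89.B8Thm8TorusWitness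

end
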